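/-
Copyright: lit-balaban Phase-2 proof seat p34 (gen 18).  Statement-level skeleton of a published paper; no proof claims beyond what the
kernel checks below.
-/
import Literature.MathematicalPhysics.QuantumFieldTheory.BalabanImbrieJaffe1984to88.BIJ85BlockKPoincare
import Literature.MathematicalPhysics.QuantumFieldTheory.BalabanImbrieJaffe1984to88.BIJ88NeumannNoZeroModesTorus

/-!
# [BalabanImbrieJaffe1988] (2.27)/(2.30) p. 263 / [BalabanImbrieJaffe1985] §7.3 p. 326 — **THE SCALE-`L^j` NASH INEQUALITY ON A UNION OF
# `k`-BLOCKS OF THE FINE TORUS: `‖g‖₂² ≤ (L^{2j}/2)·E_Ω(g) + L^{−jD}‖g‖₁²` (`j ≤ k`, `g` supported in `Ω`)** — engine file 2 of 3 behind the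
# `k`-uniform SUP-NORM (operator-form) decay of the REGION Neumann propagators `G_k(Ω,u)` on an ARBITRARY block union (the dimension input of
# the Nash–Davies iteration of file 3), from p33's `k`-block Poincaré inequality `BIJ85BlockKPoincare.var_blockK_le` BY NAME

T. Bałaban, J. Imbrie, A. Jaffe, *Effective action and cluster properties of the abelian Higgs model*, Commun. Math. Phys. **114** (1988)
257–315 [BalabanImbrieJaffe1988], Sect. 2 p. 263 [PDF 7], (2.27)/(2.30); [I] = T. Bałaban, J. Imbrie, A. Jaffe, *Renormalization of the Higgs
model: minimizers, propagators and the stability of mean field theory*, Commun. Math. Phys. **97** (1985) 299–329 [BalabanImbrieJaffe1985],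
§7.3 p. 326 [PDF 28], (5.1.2)–(5.1.3) p. 313; [6] = T. Bałaban, *Regularity and decay of lattice Green's functions*, Commun. Math. Phys. **89**
(1983) 571–597 [Balaban1983RegularityDecay], (1.10) p. 573.

statement-level skeleton of published theorems with citation tags; proofs where landed; nothing here is a claim about the Yang–Mills mass gap

PDF held: `paper:balaban1988-cmp114-bij-abelian-higgs-effective-action` (journal page = PDF page + 256), p. 262–263 [PDF 6–7];
`paper:balaban1985-cmp97-bij-higgs-minimizers` (journal page = PDF page + 298), p. 326 [PDF 28].

CITATION HEADER (lean-in-tree rule).  Part of the lit-balaban TYPED SKELETON (HOME `run/shared/lean/pub/lit-balaban/`), PHASE-2 proof seat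
p34 gen 18 (unit `lit-balaban-p34-g18`; TAKING line HOME/STATUS.md 2026-08-23T04:22:50Z; free-target protocol G.5-34(d) — source: the
owner's `HOME/lit-balaban-r18/C2S14-CLOSURE.md` v1.16s «REMAINING NON-FLAT FRONT (α′) operator-form (H1.10) for general regions at small u»).
WHAT IS REPRODUCED: nothing printed is restated — ENGINE file (pure lattice analysis) behind a located member of rows **C2.Eq2.30** (owner r18)
and **C1.Eq7.3.1-7.3.2** (owner r15), the (1.10) VALUE member in OPERATOR form for p31's region propagators on a GENERAL `k`-block union at
non-flat small `u` (file 4).  USED BY NAME: p33's `BIJ85BlockKPoincare.var_blockK_le` (the `k`-block Poincaré inequality, constant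
`(L^k−1)L^k/2`) and `val_blkIter`, p11's `BIJ85BlockAveragesTorusK.blockK`/`card_blockK`/`sum_blockK_sum`, pub-balaban's
`Beta.BlockPoincare.avg`/`sum_sq_sub_eq`, p31's `BIJ88NeumannNoZeroModesTorus.IsBlockUnion`, r18's `starB`.  Kind «theorems only» (no
definition, no `Prop`-valued fact).

THE PRINTED TEXT (verbatim).  C2 p. 263 [PDF 7]: *"a straightforward application of the random walk expansion of [6] shows that
|(G_{k,loc}(u)f)(x)| ≦ ce^{−c dist(suppt f,x)}‖f‖_∞, (2.30)"*; [I] p. 326: *"The propagators arising from Δ_k(u_k), under the restriction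
(7.3.1) on the gauge field, also satisfy the regularity and decay estimates of [7]"*.

THE MECHANISM (DIVERGENCE OF METHOD from [6]'s random walk expansion, disclosed).  The sup-norm (operator) form of (1.10)/(2.30) for a REGION
propagator needs an `ℓ² → ℓ^∞` conversion at the scale `L^k` that costs exactly `L^{−kD/2}` (file 3's tilted row bound).  For a general union
of `k`-blocks — where [6]'s multiscale box pieces are not available — files 1–3 obtain it by a discrete Nash–Davies iteration, whose dimension
input is the present inequality: for `g` supported in a `k`-block union `Ω` and every `j ≤ k`, split `‖g‖₂²` over the `j`-blocks `B^j(y)` (they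
partition the torus and refine the `k`-blocks); on each block `Σ_{B}g² = Σ_B(g − ḡ)² + (Σ_Bg)²/|B| ≤ ((L^j−1)L^j/2)E_B(g) + L^{−jD}(Σ_B|g|)²`
(p33's Poincaré inequality, `|B^j(y)| = L^{jD}`); summing, the in-block bonds carrying a nonzero difference lie in `Ω*` (a bond inside a
`j`-block is inside a `k`-block, which is inside or outside `Ω` as a whole), and `Σ_y(Σ_{B^j(y)}|g|)² ≤ (Σ|g|)²` — summing the blocks costs
nothing.

WHAT IS PROVED (theorems only; 0 `sorry`; standard axioms).
* §1 `blkIter_eq_of_le` (same `j`-block ⟹ same `k`-block, `j ≤ k`), `mem_iff_of_blkIter_eq` (a `k`-block union contains both ends of an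
  in-block bond or neither), `sum_sq_blockK_le` (the per-block estimate).
* §2 **`nash_blockUnion`**: for `k ≤ m + K`, `j ≤ k`, `Ω` a union of `k`-blocks and `g` vanishing off `Ω`,
  `Σ_y g(y)² ≤ ((L^j)²/2)·Σ_{b∈Ω*}(g(b₊) − g(b₋))² + ((L^j)^D)⁻¹·(Σ_y|g(y)|)²` (`D = P.d`).

HONEST SCOPE.  Pure lattice analysis on the fine torus `Site P 0` (no gauge field); the inequality is the standard local Nash inequality at
the scales `L^j ≤ L^k` and nothing finer is claimed (no statement at scales between the powers of `L`; file 3's descent is `L`-adic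
accordingly); constants explicit.  Nothing here is summit progress.  Unit `lit-balaban-p34` (literature-prover-lit-balaban-p34-g18-0), HOME
`run/shared/lean/pub/lit-balaban/`, 2026-08-23.
-/

open scoped BigOperators
open Finset

namespace Literature.MathematicalPhysics.QuantumFieldTheory.BalabanImbrieJaffe1984to88.BIJ88BlockUnionNash

open Literature.MathematicalPhysics.QuantumFieldTheory.Balaban1983to89
open BIJ88Sect3Statements (starB mem_starB)
open BIJ85BlockAveragesTorusK (blkIter blockK mem_blockK card_blockK mem_blockK_blkIter)
open BIJ85BlockAveragingIneq (sum_blockK_sum)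
open BIJ85BlockKPoincare (val_blkIter var_blockK_le)
open BIJ88NeumannNoZeroModesTorus (IsBlockUnion)
open Beta.BlockPoincare (avg sum_sq_sub_eq)

noncomputable section

variable {P : Params}

/-! ## §1 Block nesting and the per-block estimate -/

/-- kernel: **a `j`-block lies inside a `k`-block for `j ≤ k`**: `x_j = x′_j ⟹ x_k = x′_k` (labels `⌊⌊n/L^j⌋/L^{k−j}⌋ = ⌊n/L^k⌋`).
[cite: BalabanImbrieJaffe1985, (5.1.2)–(5.1.3) p.313] -/
theorem blkIter_eq_of_le {j k : ℕ} (hk : k ≤ P.m + P.K) (hjk : j ≤ k) {x x' : Balaban1983to89.Site P 0}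
    (h : blkIter j x = blkIter j x') : blkIter k x = blkIter k x' := by
  have hj0 : 0 + j ≤ P.m + P.K := by omega
  have hk0 : 0 + k ≤ P.m + P.K := by omega
  funext μ
  apply ZMod.val_injective
  have hμ : (blkIter j x μ).val = (blkIter j x' μ).val := by rw [h]
  rw [val_blkIter j hj0 x μ, val_blkIter j hj0 x' μ] at hμ
  rw [val_blkIter k hk0 x μ, val_blkIter k hk0 x' μ]
  have e : P.L ^ k = P.L ^ j * P.L ^ (k - j) := by rw [← pow_add]; congr 1; omega
  rw [e, ← Nat.div_div_eq_div_mul, ← Nat.div_div_eq_div_mul, hμ]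

/-- kernel: **a union of `k`-blocks contains both ends of a bond inside a `j`-block, `j ≤ k`, or neither**.
[cite: BalabanImbrieJaffe1988, (2.27) p.263] -/
theorem mem_iff_of_blkIter_eq {j k : ℕ} (hk : k ≤ P.m + P.K) (hjk : j ≤ k) {Ω : Finset (Balaban1983to89.Site P 0)}
    (hΩ : IsBlockUnion k Ω) {x x' : Balaban1983to89.Site P 0} (h : blkIter j x = blkIter j x') : x ∈ Ω ↔ x' ∈ Ω := by
  have hkk := blkIter_eq_of_le hk hjk h
  constructor
  · intro hx
    exact hΩ x hx (mem_blockK.2 hkk.symm)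
  · intro hx'
    exact hΩ x' hx' (mem_blockK.2 hkk)

/-- kernel: **the per-block estimate** `Σ_{x∈B^j(y)}g(x)² ≤ ((L^j)²/2)·Σ_{b : b₋,b₊∈B^j(y)}(g(b₊) − g(b₋))² + ((L^j)^D)⁻¹(Σ_{x∈B^j(y)}|g(x)|)²`
(Steiner about `0`, p33's block Poincaré inequality, `|B^j(y)| = L^{jD}`). [cite: BalabanImbrieJaffe1985, (7.3.2) p.326] -/
theorem sum_sq_blockK_le {j : ℕ} (hj : j ≤ P.m + P.K) (y : Balaban1983to89.Site P (0 + j)) (g : Balaban1983to89.Site P 0 → ℝ) :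
    ∑ x ∈ blockK j y, g x ^ 2 ≤
      ((P.L : ℝ) ^ j) ^ 2 / 2 * ∑ b ∈ univ.filter (fun b : PBond P 0 => blkIter j b.src = y ∧ blkIter j b.tgt = y), (g b.tgt - g b.src) ^ 2
        + (((P.L : ℝ) ^ j) ^ P.d)⁻¹ * (∑ x ∈ blockK j y, |g x|) ^ 2 := by
  have hj0 : 0 + j ≤ P.m + P.K := by omega
  have hL : (1 : ℝ) ≤ P.L := by exact_mod_cast P.L_pos
  have hLj : (1 : ℝ) ≤ (P.L : ℝ) ^ j := one_le_pow₀ hL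
  have hcard : ((blockK j y).card : ℝ) = ((P.L : ℝ) ^ j) ^ P.d := by
    rw [card_blockK j hj0 y, Nat.cast_pow, ← pow_mul]
  have hNpos : (0 : ℝ) < ((P.L : ℝ) ^ j) ^ P.d := by positivity
  -- Steiner about `0`
  have hS := sum_sq_sub_eq (blockK j y) g 0
  simp only [sub_zero] at hS
  -- the block Poincaré inequality, constant `(L^j−1)L^j/2 ≤ (L^j)²/2`
  have hP := var_blockK_le hj0 y g
  have hE : 0 ≤ ∑ b ∈ univ.filter (fun b : PBond P 0 => blkIter j b.src = y ∧ blkIter j b.tgt = y), (g b.tgt - g b.src) ^ 2 :=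
    sum_nonneg fun _ _ => sq_nonneg _
  have hC : ((P.L : ℝ) ^ j - 1) * (P.L : ℝ) ^ j / 2 ≤ ((P.L : ℝ) ^ j) ^ 2 / 2 := by nlinarith
  have hP' := hP.trans (mul_le_mul_of_nonneg_right hC hE)
  -- the mean term: `|B|·avg² = (Σ_B g)²/|B| ≤ (Σ_B |g|)²/|B|`
  have hmean : ((blockK j y).card : ℝ) * (avg (blockK j y) g) ^ 2 ≤ (((P.L : ℝ) ^ j) ^ P.d)⁻¹ * (∑ x ∈ blockK j y, |g x|) ^ 2 := by
    rw [avg, hcard, div_pow]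
    have h1 : (∑ x ∈ blockK j y, g x) ^ 2 ≤ (∑ x ∈ blockK j y, |g x|) ^ 2 := by
      have h := abs_sum_le_sum_abs g (blockK j y)
      have h0 : 0 ≤ |∑ x ∈ blockK j y, g x| := abs_nonneg _
      nlinarith [sq_abs (∑ x ∈ blockK j y, g x)]
    calc ((P.L : ℝ) ^ j) ^ P.d * ((∑ x ∈ blockK j y, g x) ^ 2 / (((P.L : ℝ) ^ j) ^ P.d) ^ 2)
        = (((P.L : ℝ) ^ j) ^ P.d)⁻¹ * (∑ x ∈ blockK j y, g x) ^ 2 := by field_simp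
      _ ≤ (((P.L : ℝ) ^ j) ^ P.d)⁻¹ * (∑ x ∈ blockK j y, |g x|) ^ 2 := mul_le_mul_of_nonneg_left h1 (by positivity)
  rw [hS]
  linarith

/-! ## §2 The scale-`L^j` Nash inequality on a union of `k`-blocks -/

/-- **THE SCALE-`L^j` NASH INEQUALITY ON A `k`-BLOCK UNION**: for `k ≤ m + K`, `j ≤ k`, `Ω` a union of `k`-blocks of the fine torus and `g`
vanishing off `Ω`: `Σ_y g(y)² ≤ ((L^j)²/2)·Σ_{b∈Ω*}(g(b₊) − g(b₋))² + ((L^j)^D)⁻¹·(Σ_y |g(y)|)²` — the per-block estimate summed over the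
`j`-blocks: an in-block bond with a nonzero difference lies in `Ω*` (`mem_iff_of_blkIter_eq`), and `Σ_y(Σ_{B^j(y)}|g|)² ≤ (Σ|g|)²`.  The
dimension input of the Nash–Davies iteration behind the operator form of (1.10)/(2.30) for region propagators (file 3).
[cite: BalabanImbrieJaffe1985, (7.3.2) p.326] -/
theorem nash_blockUnion {j k : ℕ} (hk : k ≤ P.m + P.K) (hjk : j ≤ k) {Ω : Finset (Balaban1983to89.Site P 0)} (hΩ : IsBlockUnion k Ω)
    {g : Balaban1983to89.Site P 0 → ℝ} (hg : ∀ y, y ∉ Ω → g y = 0) :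
    ∑ y, g y ^ 2 ≤ ((P.L : ℝ) ^ j) ^ 2 / 2 * ∑ b ∈ starB Ω, (g b.tgt - g b.src) ^ 2 + (((P.L : ℝ) ^ j) ^ P.d)⁻¹ * (∑ y, |g y|) ^ 2 := by
  classical
  have hj : j ≤ P.m + P.K := hjk.trans hk
  set S : Balaban1983to89.Site P (0 + j) → Finset (PBond P 0) :=
    fun y => univ.filter (fun b : PBond P 0 => blkIter j b.src = y ∧ blkIter j b.tgt = y) with hSdef
  set G : PBond P 0 → ℝ := fun b => (g b.tgt - g b.src) ^ 2 with hG
  -- the blocks partition the torus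
  have hpart : ∑ y, g y ^ 2 = ∑ y : Balaban1983to89.Site P (0 + j), ∑ x ∈ blockK j y, g x ^ 2 := (sum_blockK_sum (k := j) _).symm
  have hpart1 : ∑ y, |g y| = ∑ y : Balaban1983to89.Site P (0 + j), ∑ x ∈ blockK j y, |g x| := (sum_blockK_sum (k := j) _).symm
  -- per block
  have hblk := fun y : Balaban1983to89.Site P (0 + j) => sum_sq_blockK_le hj y g
  have h1 : ∑ y, g y ^ 2 ≤ ∑ y : Balaban1983to89.Site P (0 + j),
      (((P.L : ℝ) ^ j) ^ 2 / 2 * ∑ b ∈ S y, G b + (((P.L : ℝ) ^ j) ^ P.d)⁻¹ * (∑ x ∈ blockK j y, |g x|) ^ 2) := by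
    rw [hpart]; exact sum_le_sum fun y _ => hblk y
  rw [sum_add_distrib, ← mul_sum, ← mul_sum] at h1
  -- the in-block bonds with a nonzero difference lie in `Ω*`
  have hbond : ∑ y : Balaban1983to89.Site P (0 + j), ∑ b ∈ S y, G b ≤ ∑ b ∈ starB Ω, G b := by
    set G' : PBond P 0 → ℝ := fun b => if b ∈ starB Ω then G b else 0 with hG'
    have hGG : ∀ y, ∀ b ∈ S y, G b = G' b := by
      intro y b hb
      simp only [hSdef, mem_filter, mem_univ, true_and] at hb
      by_cases hst : b ∈ starB Ω
      · simp only [hG', if_pos hst]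
      · simp only [hG', if_neg hst]
        have hsame : blkIter j b.src = blkIter j b.tgt := hb.1.trans hb.2.symm
        have hiff := mem_iff_of_blkIter_eq hk hjk hΩ hsame
        rw [mem_starB] at hst
        have hs : b.src ∉ Ω := fun h => hst ⟨h, hiff.1 h⟩
        have ht : b.tgt ∉ Ω := fun h => hs (hiff.2 h)
        simp only [hG, hg _ hs, hg _ ht, sub_self]
        ring
    have hG'nn : ∀ b, 0 ≤ G' b := fun b => by
      simp only [hG']; split_ifs
      · exact sq_nonneg _
      · exact le_rfl
    calc ∑ y : Balaban1983to89.Site P (0 + j), ∑ b ∈ S y, G b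
        = ∑ y : Balaban1983to89.Site P (0 + j), ∑ b ∈ S y, G' b := sum_congr rfl fun y _ => sum_congr rfl fun b hb => hGG y b hb
      _ ≤ ∑ y : Balaban1983to89.Site P (0 + j), ∑ b ∈ univ.filter (fun b : PBond P 0 => blkIter j b.src = y), G' b :=
          sum_le_sum fun y _ => sum_le_sum_of_subset_of_nonneg
            (fun b hb => by simp only [hSdef, mem_filter, mem_univ, true_and] at hb ⊢; exact hb.1) fun _ _ _ => hG'nn _
      _ = ∑ b : PBond P 0, G' b := sum_fiberwise univ (fun b : PBond P 0 => blkIter j b.src) G'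
      _ = ∑ b ∈ starB Ω, G b := by rw [hG', ← sum_filter]; congr 1; ext b; simp
  -- summing the blocks costs nothing on the `ℓ¹` side
  have hl1 : ∑ y : Balaban1983to89.Site P (0 + j), (∑ x ∈ blockK j y, |g x|) ^ 2 ≤ (∑ y, |g y|) ^ 2 := by
    rw [hpart1]
    exact sum_sq_le_sq_sum_of_nonneg fun y _ => sum_nonneg fun x _ => abs_nonneg _
  have hL : (0 : ℝ) ≤ ((P.L : ℝ) ^ j) ^ 2 / 2 := by positivity
  have hN : (0 : ℝ) ≤ (((P.L : ℝ) ^ j) ^ P.d)⁻¹ := by positivity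
  calc ∑ y, g y ^ 2 ≤ ((P.L : ℝ) ^ j) ^ 2 / 2 * ∑ y : Balaban1983to89.Site P (0 + j), ∑ b ∈ S y, G b +
        (((P.L : ℝ) ^ j) ^ P.d)⁻¹ * ∑ y : Balaban1983to89.Site P (0 + j), (∑ x ∈ blockK j y, |g x|) ^ 2 := h1
    _ ≤ ((P.L : ℝ) ^ j) ^ 2 / 2 * ∑ b ∈ starB Ω, G b + (((P.L : ℝ) ^ j) ^ P.d)⁻¹ * (∑ y, |g y|) ^ 2 :=
        add_le_add (mul_le_mul_of_nonneg_left hbond hL) (mul_le_mul_of_nonneg_left hl1 hN)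

end

end Literature.MathematicalPhysics.QuantumFieldTheory.BalabanImbrieJaffe1984to88.BIJ88BlockUnionNash
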